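import Summits.QuantumFields.YangMills.Theorems.IR.BlockedActivityWRefineGen
import Summits.QuantumFields.YangMills.Theorems.IR.BlockedActivityWFormatRobust
import Summits.QuantumFields.YangMills.Theorems.IR.BlockedActivityWOnsetIff
import HarnessLib

/-!
# Crux `IR` (stmt-QuantumFields-19354), lane B «strong coupling AFTER BLOCKING»: TAIL COFINALITY — a universal mixing mesh `b` makes EVERY mesh `B ≥ B₀`
# a mixing mesh (and a W-mesh), at every `β`; the onset statements in «eventually-in-the-mesh» form

Helper module for item `stmt-QuantumFields-19354` (`--supports`; it closes nothing), lane `ym-19354-onsetsc-p2` (g6); the variable-piece refinement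
`refineGen` of `Theorems/IR/BlockedActivityWRefineGen` run through the chain of `Theorems/IR/BlockedActivityWOfMixing` ∕ `…WMeshCofinal` ∕ `…WFormatRobust`
(which reached only the MULTIPLES `K·b`).

* ★ `univShellCond_coarsen_any` — `UnivShellCond ρ β b n ε` (`b ≥ 1`, `ε ≥ 0`, continuous `ρ`, Hausdorff second-countable `G`), `b ≤ B`, `n' ≥ 1`, `j(2n+1) ≤ 2(B∕b)` ⇒
  **`UnivShellCond ρ β B n' ((2(B∕b)+1)⁴ · (ε·shellCount n)^j)`** — ANY coarser mesh, not only multiples.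
* ★ `univShellCond_tail_threshold` — ONE `K₀(n, ε; n', ε')` with: `UnivShellCond ρ β b n ε`, `ε·shellCount n < 1` ⇒ `UnivShellCond ρ β B n' ε'` for EVERY `B ≥ K₀·b`;
  `mixSet_tail` (the tree's `OnsetFormats.mixSet ρ β n' ε'` contains the tail `[K₀·b, ∞)`): **the set of mixing meshes contains a TAIL — mixing in the mesh is a
  threshold phenomenon up to the tolerance bookkeeping**; `univOnsetAt_iff_eventually`, ★ `onsetMixing_iff_eventually` (`OnsetMixing ↔` «every compact simple `G`, every `r`:
  `∃ β₂, ∀ β ≥ β₂, ∃ B₀, ∀ B ≥ B₀, UnivShellCond r.ρ β B 1 (1∕3552)`»).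
* §3 (appended): `mixOnset_le_mul_of_mem_mixSet`, ★ `mixOnset_grade_robust` — the format's onset MESH `mixOnset ρ β n ε` (tree, `sInf mixSet`) is grade-robust up to a
  `β`-INDEPENDENT factor: `mixOnset ρ β n' ε' ≤ K₀(n,ε;n',ε') · mixOnset ρ β n ε`.
* ★ `blockedActivityClassW_of_univShellCond_any` — TV ⇒ W at ANY coarse mesh: `j(2n+1) + 2 ≤ B∕b` ⇒ `BlockedActivityClassW r.ρ β B 1 (mixingRadius r.N β θ B j)`;
  `blockedActivityClassW_tail_of_univShellCond` (every radius at EVERY mesh `B ≥ B₀(β, b, a)`); ★ `blockedActivityOnsetAtW_iff_eventually`.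

HONEST FRAMING: format∕currency bookkeeping at every `β`; the universal shell condition at some mesh is ASSUMED; nothing about the onset at `b(β) ≍ ξ(β)`, a gap or
Clay.  No `sorry`; axioms ⊆ {propext, Classical.choice, Quot.sound}; no instances, no notation.
-/

set_option autoImplicit false

noncomputable section

open MeasureTheory ProbabilityTheory Filter Topology
open Literature.MathematicalPhysics
open Literature.MathematicalPhysics.QuantumFieldTheory (LatticeRep IsCompactSimpleLieGroup)
open Literature.MathematicalPhysics.QuantumLattice
open Summit.QuantumFields.YangMills.Cruxes.IR.Tempered (cellEdges windowCells regionEdges collarEdges)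
open Summit.QuantumFields.YangMills.Cruxes.IR.CellTempered.Engine (frameCell frameCell_eq_iff mem_cellEdges_frameCell frame_hC1 finite_frameCell
  regionEdges_union shiftFrame shiftFrame_mesh)
open Summit.QuantumFields.YangMills.Cruxes.IR.OnsetFormats (shellCount UnivShellCond OnsetMixing mixSet)
open Summit.QuantumFields.YangMills.Cruxes.IR.AfPincerUc.Calibration (windowCells_subset_windowCellsPlus)
open Summit.QuantumFields.YangMills.Theorems.FiniteSizeCriterion (multiCell_influence_general multiCell_influence_general_of_abs_le)

namespace Summit.QuantumFields.YangMills.Cruxes.IR.BlockedActivity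

/-! ## §1 The format at ANY coarser mesh -/

section CoarsenAny

variable {G : Type} [Group G] [TopologicalSpace G] [IsTopologicalGroup G] [CompactSpace G] [MeasurableSpace G] [BorelSpace G]
  [SecondCountableTopology G] [T2Space G] {N : ℕ} (ρ : G →* Matrix (Fin N) (Fin N) ℂ)

/-- ★ **THE FORMAT COARSENS TO ANY MESH.**  For continuous `ρ`: `UnivShellCond ρ β b n ε` (`b ≥ 1`, `ε ≥ 0`), `b ≤ B`, `n' ≥ 1`, `j(2n+1) ≤ 2(B∕b)` ⇒
`UnivShellCond ρ β B n' ((2(B∕b)+1)⁴ · (ε·shellCount n)^j)`. -/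
theorem univShellCond_coarsen_any (hρ : Continuous ρ) {β ε : ℝ} {b n : ℕ} (hb : 1 ≤ b) (hε : 0 ≤ ε) (hU : UnivShellCond ρ β b n ε)
    {B : ℕ} (hbB : b ≤ B) {n' : ℕ} (hn' : 1 ≤ n') (j : ℕ) (hj : j * (2 * n + 1) ≤ 2 * (B / b)) :
    UnivShellCond ρ β B n' ((((2 * (B / b) + 1) ^ 4 : ℕ) : ℝ) * (ε * shellCount n) ^ j) := by
  classical
  intro w hw Y hY h0 σ σ' hagree f hf hfm hf01
  have hw' : AfPincerUc.IsFrame B w := hw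
  have hu : AfPincerUc.IsFrame b (refineGen b w) := isFrame_refineGen hb hbB hw'
  have hw1 := frame_step hw' (hb.trans hbB)
  have hγ := QuantumFieldTheory.isSpecification_ymSpecification_of_t2Space (d := 4) ρ hρ β
  have hθ : 0 ≤ (ε * shellCount n) ^ j := pow_nonneg (mul_nonneg hε (shellCount_nonneg' n)) j
  set Y0 : Finset Cell := (cellEdges w 0).image (frameCell (refineGen b w)) with hY0
  have hbox := fineCells_centre_subset_gen hb hbB hw'
  have hdep : DependsOn f {v | frameCell (refineGen b w) v ∈ Y0} := by
    intro U V hUV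
    refine hf fun e he => hUV e ?_
    show frameCell (refineGen b w) e ∈ Y0
    rw [hY0]
    exact Finset.mem_image_of_mem (frameCell (refineGen b w)) (Finset.mem_coe.1 he)
  have hR : ∀ (Λ : Finset (ZdEdge 4)), (∀ v v', frameCell (refineGen b w) v = frameCell (refineGen b w) v' → v ∈ Λ → v' ∈ Λ) →
      ∀ (y : Cell) (g : LGConfig 4 G → ℝ), Measurable g → (∀ σ, 0 ≤ g σ ∧ g σ ≤ 1) →
      DependsOn g {v | frameCell (refineGen b w) v = y} →
      ∀ ζ ζ' : LGConfig 4 G, (∀ v, v ∉ Λ → (∀ i, |frameCell (refineGen b w) v i - y i| ≤ j * (2 * n + 1)) → ζ v = ζ' v) →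
        |∫ σ, g σ ∂(ymSpecification ρ β Λ ζ) - ∫ σ, g σ ∂(ymSpecification ρ β Λ ζ')| ≤ (ε * shellCount n) ^ j :=
    fun Λ hΛ y g hgm hg01 hgdep ζ ζ' hag => univShellCond_cell_decay ρ hρ hb hε hU hu j Λ hΛ y g hgm hg01 hgdep ζ ζ' hag
  have hagree' : ∀ y ∈ Y0, ∀ v, v ∉ regionEdges w Y →
      (∀ i, |frameCell (refineGen b w) v i - y i| ≤ j * (2 * n + 1)) → σ v = σ' v := by
    intro y hy v hv hnear
    have hyb := Fintype.mem_piFinset.1 (hbox hy)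
    have hvc := mem_cellEdges_frameCell hw1 v
    have hcY : frameCell w v ∉ Y := fun h => hv (Finset.mem_biUnion.2 ⟨_, h, hvc⟩)
    have hcW : frameCell w v ∈ windowCells n' := by
      rw [frameCell_eq_coarseIdx_refineGen hb hbB hw']
      simp only [Summit.QuantumFields.YangMills.Cruxes.IR.Tempered.windowCells, Fintype.mem_piFinset, Finset.mem_Icc]
      intro i
      have hyi := Finset.mem_Ico.1 (hyb i)
      have hN : |frameCell (refineGen b w) v i - y i| ≤ ((j * (2 * n + 1) : ℕ) : ℤ) := by push_cast; exact hnear i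
      have hcc := coarseIdx_mem_Icc_of_near hb hbB hw' hj i hyi.1 hyi.2 hN
      have hn1 : (1 : ℤ) ≤ (n' : ℤ) := by exact_mod_cast hn'
      constructor <;> linarith [hcc.1, hcc.2]
    exact hagree (frameCell w v) (windowCells_subset_windowCellsPlus _ hcW) hcY hcW v hvc
  have hmain := multiCell_influence_general (V := ZdEdge 4) (S := G) (C := Cell) (cell := frameCell (refineGen b w))
    (near := fun y v => ∀ i, |frameCell (refineGen b w) v i - y i| ≤ j * (2 * n + 1))
    (fun v i => by rw [sub_self, abs_zero]; positivity) hγ hR Y0 (regionEdges w Y) (regionEdges_union_refineGen hb hbB hw' Y) f hfm hf01 hdep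
    σ σ' hagree'
  refine hmain.trans ?_
  have hc : (Y0.card : ℝ) ≤ (((2 * (B / b) + 1) ^ 4 : ℕ) : ℝ) := by exact_mod_cast card_fineCells_centre_le_gen hb hbB hw'
  exact mul_le_mul_of_nonneg_right hc hθ

/-- ★ **TAIL THRESHOLD (uniform).**  For `0 ≤ ε`, `ε·shellCount n < 1`, `n' ≥ 1`, `ε' > 0` there is `K₀ ≥ 1` (depending on these only) with: for every continuous `ρ`,
every `β`, every `b ≥ 1` and EVERY `B ≥ K₀·b` (not only multiples), `UnivShellCond ρ β b n ε → UnivShellCond ρ β B n' ε'`. -/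
theorem univShellCond_tail_threshold (hρ : Continuous ρ) {ε : ℝ} {n : ℕ} (hε : 0 ≤ ε) (hlt : ε * shellCount n < 1)
    {n' : ℕ} (hn' : 1 ≤ n') {ε' : ℝ} (hε' : 0 < ε') :
    ∃ K₀ : ℕ, 1 ≤ K₀ ∧ ∀ (β : ℝ) (b : ℕ), 1 ≤ b → ∀ B : ℕ, K₀ * b ≤ B → UnivShellCond ρ β b n ε → UnivShellCond ρ β B n' ε' := by
  have hθ0 : 0 ≤ ε * shellCount n := mul_nonneg hε (shellCount_nonneg' n)
  have hT := pow_four_mul_geom_tendsto_zero hθ0 hlt (2 * n + 1) (2 * n + 1) 1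
  obtain ⟨j₀, hj₀⟩ := eventually_atTop.1 (hT.eventually (gt_mem_nhds hε'))
  refine ⟨j₀ * (2 * n + 1) + 1, by omega, fun β b hb B hB hU => ?_⟩
  have hpos : 0 < 2 * n + 1 := by omega
  -- `K = B / b ≥ K₀`
  have hK : j₀ * (2 * n + 1) + 1 ≤ B / b := (Nat.le_div_iff_mul_le (by omega)).2 hB
  have hbB : b ≤ B := le_trans (Nat.le_mul_of_pos_left b (by omega)) hB
  set K : ℕ := B / b with hKdef
  have hjK : 2 * K / (2 * n + 1) * (2 * n + 1) ≤ 2 * K := Nat.div_mul_le_self (2 * K) (2 * n + 1)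
  have hlt' : 2 * K < 2 * K / (2 * n + 1) * (2 * n + 1) + (2 * n + 1) := Nat.lt_div_mul_add hpos
  have hj₀j : j₀ ≤ 2 * K / (2 * n + 1) := (Nat.le_div_iff_mul_le hpos).2 (by omega)
  have hUc := univShellCond_coarsen_any ρ hρ hb hε hU hbB hn' (2 * K / (2 * n + 1)) hjK
  set j : ℕ := 2 * K / (2 * n + 1) with hj
  refine univShellCond_of_le ρ hUc ?_
  have hθj : 0 ≤ (ε * shellCount n) ^ j := pow_nonneg hθ0 j
  have hKj : 2 * K + 1 ≤ (j * (2 * n + 1) + (2 * n + 1)) * 1 := by omega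
  have hKle : (((2 * K + 1) ^ 4 : ℕ) : ℝ) ≤ ((((j * (2 * n + 1) + (2 * n + 1)) * 1 : ℕ)) : ℝ) ^ 4 := by
    have : (2 * K + 1) ^ 4 ≤ ((j * (2 * n + 1) + (2 * n + 1)) * 1) ^ 4 := Nat.pow_le_pow_left hKj 4
    exact_mod_cast this
  calc (((2 * K + 1) ^ 4 : ℕ) : ℝ) * (ε * shellCount n) ^ j ≤ ((((j * (2 * n + 1) + (2 * n + 1)) * 1 : ℕ)) : ℝ) ^ 4 * (ε * shellCount n) ^ j :=
        mul_le_mul_of_nonneg_right hKle hθj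
    _ ≤ ε' := (hj₀ j hj₀j).le

/-- **The set of mixing meshes contains a TAIL**: `UnivShellCond ρ β b n ε` (admissible) ⇒ for every grade `(n', ε')` there is `B₀` with `B ∈ mixSet ρ β n' ε'` for all
`B ≥ B₀`. -/
theorem mixSet_tail (hρ : Continuous ρ) {β ε : ℝ} {b n : ℕ} (hb : 1 ≤ b) (hε : 0 ≤ ε) (hlt : ε * shellCount n < 1) (hU : UnivShellCond ρ β b n ε)
    {n' : ℕ} (hn' : 1 ≤ n') {ε' : ℝ} (hε' : 0 < ε') :
    ∃ B₀ : ℕ, ∀ B : ℕ, B₀ ≤ B → B ∈ mixSet ρ β n' ε' := by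
  obtain ⟨K₀, hK₀, h⟩ := univShellCond_tail_threshold ρ hρ hε hlt hn' hε'
  refine ⟨K₀ * b, fun B hB => ⟨?_, h β b hb B hB hU⟩⟩
  exact le_trans (Nat.one_le_iff_ne_zero.2 (Nat.mul_ne_zero (by omega) (by omega))) hB

/-- **Canonical «eventually-in-the-mesh» form (per `(G, ρ)`)**: universal onset at some admissible grade ↔ `∃ β₂, ∀ β ≥ β₂, ∃ B₀, ∀ B ≥ B₀, UnivShellCond ρ β B 1 (1∕3552)`. -/
theorem univOnsetAt_iff_eventually (hρ : Continuous ρ) :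
    (∃ (n : ℕ) (ε : ℝ), 1 ≤ n ∧ 0 ≤ ε ∧ ε * shellCount n < 1 ∧ ∃ β₂ : ℝ, ∀ β : ℝ, β₂ ≤ β → ∃ b : ℕ, 1 ≤ b ∧ UnivShellCond ρ β b n ε) ↔
      ∃ β₂ : ℝ, ∀ β : ℝ, β₂ ≤ β → ∃ B₀ : ℕ, ∀ B : ℕ, B₀ ≤ B → UnivShellCond ρ β B 1 (1 / 3552) := by
  constructor
  · rintro ⟨n, ε, -, hε, hlt, β₂, hβ⟩
    obtain ⟨K₀, hK₀, h⟩ := univShellCond_tail_threshold ρ hρ hε hlt (le_refl 1) (by norm_num : (0 : ℝ) < 1 / 3552)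
    refine ⟨β₂, fun β hle => ?_⟩
    obtain ⟨b, hb1, hU⟩ := hβ β hle
    exact ⟨K₀ * b, fun B hB => h β b hb1 B hB hU⟩
  · rintro ⟨β₂, hβ⟩
    refine ⟨1, 1 / 3552, le_rfl, by norm_num, by rw [shellCount_one]; norm_num, β₂, fun β hle => ?_⟩
    obtain ⟨B₀, hB⟩ := hβ β hle
    exact ⟨B₀ + 1, by omega, hB (B₀ + 1) (by omega)⟩

end CoarsenAny

/-- ★ **`OnsetMixing` in «eventually-in-the-mesh» form**: `OnsetMixing ↔` «for every compact simple `G` and every `r`: `∃ β₂, ∀ β ≥ β₂, ∃ B₀, ∀ B ≥ B₀,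
UnivShellCond r.ρ β B 1 (1∕3552)`» — at all large `β`, EVERY sufficiently coarse mesh is a universal mixing mesh. -/
theorem onsetMixing_iff_eventually :
    OnsetMixing ↔
      ∀ (G : Type) [Group G] [TopologicalSpace G] [IsTopologicalGroup G] [CompactSpace G],
        IsCompactSimpleLieGroup G →
        letI : MeasurableSpace G := borel G; haveI : BorelSpace G := ⟨rfl⟩;
        ∀ r : LatticeRep G, ∃ β₂ : ℝ, ∀ β : ℝ, β₂ ≤ β → ∃ B₀ : ℕ, ∀ B : ℕ, B₀ ≤ B → UnivShellCond r.ρ β B 1 (1 / 3552) := by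
  constructor
  · intro h G _ _ _ _ hG
    letI : MeasurableSpace G := borel G
    haveI : BorelSpace G := ⟨rfl⟩
    intro r
    haveI := r.t2Space
    haveI := r.secondCountableTopology
    exact (univOnsetAt_iff_eventually r.ρ r.continuous).1 (h G hG r)
  · intro h G _ _ _ _ hG
    letI : MeasurableSpace G := borel G
    haveI : BorelSpace G := ⟨rfl⟩
    intro r
    haveI := r.t2Space
    haveI := r.secondCountableTopology
    exact (univOnsetAt_iff_eventually r.ρ r.continuous).2 (h G hG r)

/-! ## §2 The class of record at ANY coarse mesh; the W-onset in «eventually» form -/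

section ClassWAny

variable (G : Type) [Group G] [TopologicalSpace G] [IsTopologicalGroup G] [CompactSpace G] [MeasurableSpace G] [BorelSpace G]
  (r : Literature.MathematicalPhysics.QuantumFieldTheory.LatticeRep G)

/-- **The influence bound for the link ratio on ANY coarse frame** (mesh `B`, `j(2n+1) + 2 ≤ B∕b`): `ι = 48·e^{12N|β|}·(ε·shellCount n)^j`. -/
theorem linkRatio_influence_of_univShellCond_any {β ε : ℝ} {b n : ℕ} (hb : 1 ≤ b) (hε : 0 ≤ ε)
    (hU : UnivShellCond r.ρ β b n ε) (j : ℕ) {B : ℕ} (hjB : j * (2 * n + 1) + 2 ≤ B / b) {w : Fin 4 → ℤ → ℤ}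
    (hw : AfPincerUc.IsFrame B w) (Y : Finset Cell) (a : ZdEdge 4) (x : G) (ω η : LGConfig 4 G)
    (hagree : ∀ z : ZdEdge 4, z ∉ innerEdges w Y → ⌊‖z.1 - a.1‖⌋₊ ≤ 2 * 1 * B → ω z = η z) :
    |(∫ V, linkRatio r.ρ β w Y a x V ∂(ymSpecification r.ρ β (innerEdges w Y) ω)) -
        ∫ V, linkRatio r.ρ β w Y a x V ∂(ymSpecification r.ρ β (innerEdges w Y) η)| ≤
      48 * Real.exp (12 * r.N * |β|) * (ε * shellCount n) ^ j := by
  classical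
  haveI := r.t2Space
  haveI := r.secondCountableTopology
  have hρ := r.continuous
  have hK1 : 1 ≤ B / b := le_trans (by omega) hjB
  have hbB : b ≤ B := by
    have h1 : B / b * b ≤ B := Nat.div_mul_le_self B b
    have h2 : b ≤ B / b * b := Nat.le_mul_of_pos_left b hK1
    exact h2.trans h1
  have hu : AfPincerUc.IsFrame b (refineGen b w) := isFrame_refineGen hb hbB hw
  have hEb : ∀ V, |linkRatio r.ρ β w Y a x V| ≤ Real.exp (12 * r.N * |β|) := fun V => by
    have h := linkRatio_bounds G r (β := β) (w := w) (Y := Y) a x V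
    rw [abs_of_pos ((Real.exp_pos _).trans_le h.1)]
    exact h.2
  have hEm : Measurable (linkRatio r.ρ β w Y a x) := by
    refine (Real.continuous_exp.comp (continuous_const.mul ?_)).measurable
    exact ((continuous_wilsonBoundaryAction r.ρ hρ (innerEdges w Y)).comp (continuous_id.update a continuous_const)).sub
      (continuous_wilsonBoundaryAction r.ρ hρ (innerEdges w Y))
  set Yc : Finset Cell := ((plaquettesTouching ({a} : Finset (ZdEdge 4))).biUnion plaquetteEdges).image
    (frameCell (refineGen b w)) with hYc
  have hdep : DependsOn (linkRatio r.ρ β w Y a x) {v | frameCell (refineGen b w) v ∈ Yc} := by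
    intro U V hUV
    refine dependsOn_linkRatio r.ρ β a x fun e he => hUV e ?_
    have he' : e ∈ (plaquettesTouching ({a} : Finset (ZdEdge 4))).biUnion plaquetteEdges := Finset.mem_coe.1 he
    show frameCell (refineGen b w) e ∈ Yc
    rw [hYc]
    exact Finset.mem_image_of_mem (frameCell (refineGen b w)) he'
  have hγ := QuantumFieldTheory.isSpecification_ymSpecification_of_t2Space (d := 4) r.ρ hρ β
  have hθ : 0 ≤ (ε * shellCount n) ^ j := pow_nonneg (mul_nonneg hε (shellCount_nonneg' n)) j
  have hR : ∀ (Λ : Finset (ZdEdge 4)), (∀ v v', frameCell (refineGen b w) v = frameCell (refineGen b w) v' → v ∈ Λ → v' ∈ Λ) →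
      ∀ (y : Cell) (g : LGConfig 4 G → ℝ), Measurable g → (∀ σ, 0 ≤ g σ ∧ g σ ≤ 1) →
      DependsOn g {v | frameCell (refineGen b w) v = y} →
      ∀ ζ ζ' : LGConfig 4 G, (∀ v, v ∉ Λ → (∀ i, |frameCell (refineGen b w) v i - y i| ≤ j * (2 * n + 1)) → ζ v = ζ' v) →
        |∫ σ, g σ ∂(ymSpecification r.ρ β Λ ζ) - ∫ σ, g σ ∂(ymSpecification r.ρ β Λ ζ')| ≤ (ε * shellCount n) ^ j :=
    fun Λ hΛ y g hgm hg01 hgdep ζ ζ' hag => univShellCond_cell_decay r.ρ hρ hb hε hU hu j Λ hΛ y g hgm hg01 hgdep ζ ζ' hag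
  have hagree' : ∀ y ∈ Yc, ∀ v, v ∉ innerEdges w Y →
      (∀ i, |frameCell (refineGen b w) v i - y i| ≤ j * (2 * n + 1)) → ω v = η v := by
    intro y hy v hv hnear
    obtain ⟨e, he, rfl⟩ := Finset.mem_image.1 hy
    refine hagree v hv ?_
    have hN : ∀ i, |frameCell (refineGen b w) v i - frameCell (refineGen b w) e i| ≤ ((j * (2 * n + 1) : ℕ) : ℤ) :=
      fun i => by push_cast; exact hnear i
    have h1 : 2 * 1 * ((j * (2 * n + 1) + 2) * b) ≤ 2 * 1 * B := by
      have : (j * (2 * n + 1) + 2) * b ≤ B / b * b := Nat.mul_le_mul_right b hjB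
      have : B / b * b ≤ B := Nat.div_mul_le_self B b
      omega
    exact (floor_norm_le_of_near_plaqNbhd hu hb he hN).trans h1
  have hmain : |(∫ V, linkRatio r.ρ β w Y a x V ∂(ymSpecification r.ρ β (innerEdges w Y) ω)) -
      ∫ V, linkRatio r.ρ β w Y a x V ∂(ymSpecification r.ρ β (innerEdges w Y) η)| ≤
      2 * Real.exp (12 * r.N * |β|) * ((Yc.card : ℝ) * (ε * shellCount n) ^ j) :=
    multiCell_influence_general_of_abs_le (V := ZdEdge 4) (S := G) (C := Cell) (cell := frameCell (refineGen b w))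
      (near := fun y v => ∀ i, |frameCell (refineGen b w) v i - y i| ≤ j * (2 * n + 1))
      (fun v i => by rw [sub_self, abs_zero]; positivity) hγ hR
      Yc (innerEdges w Y) (innerEdges_union_refineGen hb hbB hw Y) (linkRatio r.ρ β w Y a x) hEm hEb hdep ω η hagree'
  refine hmain.trans ?_
  have hcard : (Yc.card : ℝ) ≤ 24 := by exact_mod_cast Finset.card_image_le.trans (card_plaqNbhd_le a)
  have h1 : (Yc.card : ℝ) * (ε * shellCount n) ^ j ≤ 24 * (ε * shellCount n) ^ j := mul_le_mul_of_nonneg_right hcard hθ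
  have h2 := mul_le_mul_of_nonneg_left h1 (by positivity : (0 : ℝ) ≤ 2 * Real.exp (12 * r.N * |β|))
  linarith

/-- ★ **TV ⇒ W at ANY coarse mesh**: `UnivShellCond r.ρ β b n ε` (`b ≥ 1`, `ε ≥ 0`), `j(2n+1) + 2 ≤ B∕b` ⇒ `BlockedActivityClassW r.ρ β B 1 (mixingRadius r.N β (ε·shellCount n) B j)`. -/
theorem blockedActivityClassW_of_univShellCond_any {β ε : ℝ} {b n : ℕ} (hb : 1 ≤ b) (hε : 0 ≤ ε) (hU : UnivShellCond r.ρ β b n ε)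
    (j : ℕ) {B : ℕ} (hjB : j * (2 * n + 1) + 2 ≤ B / b) :
    BlockedActivityClassW r.ρ β B 1 (mixingRadius r.N β (ε * shellCount n) B j) := by
  have hθ : 0 ≤ (ε * shellCount n) ^ j := pow_nonneg (mul_nonneg hε (shellCount_nonneg' n)) j
  have hB1 : 1 ≤ B := by
    have h1 : 1 ≤ B / b := le_trans (by omega) hjB
    exact le_trans h1 (Nat.div_le_self B b)
  have h := blockedActivityClassW_of_influence G r (ι := 48 * Real.exp (12 * r.N * |β|) * (ε * shellCount n) ^ j) (by positivity) hB1 le_rfl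
    fun w hw Y _ _ a _ x ω η hag => linkRatio_influence_of_univShellCond_any G r hb hε hU j hjB hw Y a x ω η hag
  unfold mixingRadius
  rw [← sixtyfour_mul_influence_eq]
  exact h

/-- ★ **The class of record at every radius at EVERY large mesh** (`B ≥ B₀(β, b, a)`, not only multiples of `b`). -/
theorem blockedActivityClassW_tail_of_univShellCond {β ε : ℝ} {b n : ℕ} (hb : 1 ≤ b) (hε : 0 ≤ ε) (hlt : ε * shellCount n < 1)
    (hU : UnivShellCond r.ρ β b n ε) {a : ℝ} (ha : 0 < a) :
    ∃ B₀ : ℕ, ∀ B : ℕ, B₀ ≤ B → BlockedActivityClassW r.ρ β B 1 a := by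
  have hθ0 : 0 ≤ ε * shellCount n := mul_nonneg hε (shellCount_nonneg' n)
  have hT := mixingRadius_linear_tendsto_zero r.N β hθ0 hlt (2 * n + 1) (2 * n + 3) b
  obtain ⟨j₀, hj₀⟩ := eventually_atTop.1 (hT.eventually (gt_mem_nhds ha))
  refine ⟨(j₀ * (2 * n + 1) + 2) * b, fun B hB => ?_⟩
  have hpos : 0 < 2 * n + 1 := by omega
  have hK : j₀ * (2 * n + 1) + 2 ≤ B / b := (Nat.le_div_iff_mul_le (by omega)).2 hB
  set K : ℕ := B / b with hKdef
  have hle' : (K - 2) / (2 * n + 1) * (2 * n + 1) ≤ K - 2 := Nat.div_mul_le_self (K - 2) (2 * n + 1)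
  have hlt' : K - 2 < (K - 2) / (2 * n + 1) * (2 * n + 1) + (2 * n + 1) := Nat.lt_div_mul_add hpos
  have hjK : (K - 2) / (2 * n + 1) * (2 * n + 1) + 2 ≤ K := by omega
  have hj₀j : j₀ ≤ (K - 2) / (2 * n + 1) := (Nat.le_div_iff_mul_le hpos).2 (by omega)
  -- `B < (K+1)·b ≤ (j(2n+1) + 2n + 3)·b`
  have hBle : B ≤ ((K - 2) / (2 * n + 1) * (2 * n + 1) + (2 * n + 3)) * b := by
    have h1 : B < K * b + b := by rw [hKdef]; exact Nat.lt_div_mul_add (by omega)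
    have h2 : K * b + b = (K + 1) * b := by ring
    have h3 : K + 1 ≤ (K - 2) / (2 * n + 1) * (2 * n + 1) + (2 * n + 3) := by omega
    have h4 := Nat.mul_le_mul_right b h3
    omega
  refine blockedActivityClassW_mono G (blockedActivityClassW_of_univShellCond_any G r hb hε hU ((K - 2) / (2 * n + 1)) hjK) ?_
  exact (mixingRadius_mono_mesh r.N β hθ0 hBle _).trans (hj₀ _ hj₀j).le

/-- ★ **The W-onset in «eventually-in-the-mesh» form**: `BlockedActivityOnsetAtW r.ρ ↔ ∀ a > 0, ∃ β₂, ∀ β ≥ β₂, ∃ B₀, ∀ B ≥ B₀, BlockedActivityClassW r.ρ β B 1 a`. -/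
theorem blockedActivityOnsetAtW_iff_eventually :
    BlockedActivityOnsetAtW r.ρ ↔
      ∀ a : ℝ, 0 < a → ∃ β₂ : ℝ, ∀ β : ℝ, β₂ ≤ β → ∃ B₀ : ℕ, ∀ B : ℕ, B₀ ≤ B → BlockedActivityClassW r.ρ β B 1 a := by
  constructor
  · intro h a ha
    obtain ⟨n, ε, -, hε, hlt, β₂, hβ⟩ := (blockedActivityOnsetAtW_iff_univOnsetAt G r).1 h
    refine ⟨β₂, fun β hle => ?_⟩
    obtain ⟨b, hb1, hU⟩ := hβ β hle
    exact blockedActivityClassW_tail_of_univShellCond G r hb1 hε hlt hU ha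
  · intro h a ha
    obtain ⟨β₂, hβ⟩ := h a ha
    refine ⟨β₂, fun β hle => ?_⟩
    obtain ⟨B₀, hB⟩ := hβ β hle
    exact ⟨B₀ + 1, by omega, hB (B₀ + 1) (by omega)⟩

end ClassWAny

/-! ## §3 The mixing ONSET MESH is grade-robust up to a `β`-independent factor (appended, g6) -/

section OnsetMesh

variable {G : Type} [Group G] [TopologicalSpace G] [IsTopologicalGroup G] [CompactSpace G] [MeasurableSpace G] [BorelSpace G]
  [SecondCountableTopology G] [T2Space G] {N : ℕ} (ρ : G →* Matrix (Fin N) (Fin N) ℂ)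

/-- **The onset mesh at any grade is at most `K₀` times any mixing mesh of an admissible grade**: `b ∈ mixSet ρ β n ε` (`0 ≤ ε`, `ε·shellCount n < 1`) ⇒
`mixOnset ρ β n' ε' ≤ K₀(n, ε; n', ε')·b` (the tree's `OnsetFormats.mixOnset = sInf mixSet`). -/
theorem mixOnset_le_mul_of_mem_mixSet (hρ : Continuous ρ) {ε : ℝ} {n : ℕ} (hε : 0 ≤ ε) (hlt : ε * shellCount n < 1)
    {n' : ℕ} (hn' : 1 ≤ n') {ε' : ℝ} (hε' : 0 < ε') :
    ∃ K₀ : ℕ, 1 ≤ K₀ ∧ ∀ (β : ℝ) (b : ℕ), b ∈ mixSet ρ β n ε →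
      Summit.QuantumFields.YangMills.Cruxes.IR.OnsetFormats.mixOnset ρ β n' ε' ≤ K₀ * b := by
  obtain ⟨K₀, hK₀, h⟩ := univShellCond_tail_threshold ρ hρ hε hlt hn' hε'
  refine ⟨K₀, hK₀, fun β b hb => Nat.sInf_le ⟨?_, h β b hb.1 (K₀ * b) le_rfl hb.2⟩⟩
  exact Nat.one_le_iff_ne_zero.2 (Nat.mul_ne_zero (by omega) (by have := hb.1; omega))

/-- ★ **Grade robustness of the onset mesh**: ONE `K₀(n, ε; n', ε')` (independent of `G, ρ, β`) with `mixOnset ρ β n' ε' ≤ K₀ · mixOnset ρ β n ε` at every `β` at which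
the grade-`(n, ε)` mixing set is non-empty — the onset mesh `b(β)` of the format is well defined up to `β`-INDEPENDENT constants, whatever the admissible grade. -/
theorem mixOnset_grade_robust (hρ : Continuous ρ) {ε : ℝ} {n : ℕ} (hε : 0 ≤ ε) (hlt : ε * shellCount n < 1)
    {n' : ℕ} (hn' : 1 ≤ n') {ε' : ℝ} (hε' : 0 < ε') :
    ∃ K₀ : ℕ, 1 ≤ K₀ ∧ ∀ β : ℝ, (mixSet ρ β n ε).Nonempty →
      Summit.QuantumFields.YangMills.Cruxes.IR.OnsetFormats.mixOnset ρ β n' ε' ≤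
        K₀ * Summit.QuantumFields.YangMills.Cruxes.IR.OnsetFormats.mixOnset ρ β n ε := by
  obtain ⟨K₀, hK₀, h⟩ := mixOnset_le_mul_of_mem_mixSet ρ hρ hε hlt hn' hε'
  exact ⟨K₀, hK₀, fun β hne => h β _ (Nat.sInf_mem hne)⟩

end OnsetMesh

end Summit.QuantumFields.YangMills.Cruxes.IR.BlockedActivity

end
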